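import Summits.MatrixMultiplication.OmegaCensus.SmallFormats.MatMul225GF3MarginalCaps
import Summits.MatrixMultiplication.OmegaCensus.SmallFormats.MatMul22nRankGF3KernelFloor
import HarnessLib

/-!
# ω-census family (a): the X-marginal census reduction for `⟨2,2,n⟩@r` over `𝔽₃` at every rung — and the `⟨2,2,6⟩@20` cell

Cell `pub-omega` (unit `pub-omega-tensor`, gen 30), topic `Summits/MatrixMultiplication/OmegaCensus`
(sub-folder `SmallFormats`). Framing (verbatim): lottery ticket; floor = certified bounds/negative
ranges. HONEST FRAMING: the typed SKELETON of an X-marginal census, generalised from the `(n, r) =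
(5, 17)` cell (`eighteen_le_tensorRank_225_gf3_of_enumeration`) to every rung `(n, r)`:

* `succ_le_tensorRank_22n_of_orbit_census` (any field): IF every `r`-product computation of `⟨2,2,n⟩`
  has its X-marginal in the orbit (`InOrbit`) of a member of `Reps`, AND no member of `Reps` is the
  X-marginal of an `r`-product computation, THEN `r + 1 ≤ R(⟨2,2,n⟩)`.
* `xMarginal_ne_zero_of_le_tensorRank`: at a rung `r ≤ R(⟨2,2,n⟩)` (a kernel floor) no X-form of an
  `r`-product computation vanishes.
* `succ_le_tensorRank_22n_gf3_of_enumeration` (`𝔽₃`): with the floor `r ≤ R_𝔽₃(⟨2,2,n⟩)` the first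
  hypothesis becomes the purely COMBINATORIAL enumeration fact over the universe `XCaps3 n r`.
* The `⟨2,2,6⟩@20` cell (kernel window `[20, 21]`, `tensorRank_matMulTensor_22n_gf3_window`):
  `twentyone_le_tensorRank_226_gf3_of_enumeration` and `tensorRank_226_gf3_eq_of_enumeration`
  (`= 21` with the Hopcroft–Kerr ceiling); and the `(5,17)` cell restated with its ceiling,
  `tensorRank_225_gf3_eq_of_enumeration` (`= 18`).

In every statement the two hypotheses on `Reps` — ENUMERATION COMPLETE and EVERY REPRESENTATIVE
EXCLUDED — are engine-side facts of the census and are NOT proved here (for `(6,20)`: the 1 148-orbit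
list and its two code-disjoint engine exclusions; for `(5,17)`: the 62 018-orbit list, exclusions in
progress). Nothing in this file is a bound on `ω`, nor the statement 'R_𝔽₃(⟨2,2,6⟩) = 21' or
'R_𝔽₃(⟨2,2,5⟩) = 18'.
-/

namespace Summit.MatrixMultiplication.OmegaCensus.RankOnePlaneCapGeneral

open Module Matrix Literature.Computability.AlgebraicComplexity
open Summit.MatrixMultiplication.OmegaCensus.SmallFormats

variable {k : Type*} [Field k] {n : ℕ}

/-- **Census reduction, orbit form, any rung** (any field): IF every `r`-product computation of
`⟨2,2,n⟩` has its X-marginal in the orbit of a member of `Reps`, AND no member of `Reps` is the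
X-marginal of an `r`-product computation, THEN `r + 1 ≤ R(⟨2,2,n⟩)`. -/
theorem succ_le_tensorRank_22n_of_orbit_census (r : ℕ)
    (Reps : Set (Fin r → Matrix (Fin 2) (Fin 2) k))
    (hcover : ∀ β : BilinComp (mulBilin k 2 2 n) (Fin r), ∃ rep ∈ Reps, InOrbit (xMarginal β) rep)
    (hexcl : ∀ rep ∈ Reps, ∀ β : BilinComp (mulBilin k 2 2 n) (Fin r), xMarginal β ≠ rep) :
    r + 1 ≤ tensorRank (matMulTensor k 2 2 n) := by
  by_contra hlt
  obtain ⟨β⟩ := exists_bilinComp_of_tensorRank_le (k := k) (c := 2) (m := 2) (n := n) (r := r)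
    (by omega)
  obtain ⟨rep, hrep, horb⟩ := hcover β
  obtain ⟨β', hβ'⟩ := exists_xMarginal_eq_of_inOrbit β horb
  exact hexcl rep hrep β' hβ'

/-- **No dead product at a floor rung** (any field): if `r ≤ R(⟨2,2,n⟩)` then in an `r`-product
computation of `⟨2,2,n⟩` every coefficient matrix of the X-marginal is nonzero (dropping a dead product
would leave `r − 1` products). -/
theorem xMarginal_ne_zero_of_le_tensorRank {r : ℕ} (hr : r ≤ tensorRank (matMulTensor k 2 2 n))
    (β : BilinComp (mulBilin k 2 2 n) (Fin r)) (i : Fin r) : xMarginal β i ≠ 0 := by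
  classical
  intro h
  have hf : β.f i = 0 := by
    ext X
    rw [f_apply_eq_sum_xMarginal, h]
    simp
  obtain ⟨β'⟩ := exists_bilinComp_erase β hf
  have h1 := RankRowIncrement.tensorRank_le_card β'
  have h3 : Fintype.card {j // j ≠ i} = r - 1 := by
    rw [Fintype.card_subtype_compl, Fintype.card_fin, Fintype.card_unique]
  have hr0 : 0 < r := Fin.pos i
  omega

/-- **Census reduction, enumeration form, any rung over `𝔽₃`.** At a floor rung
`r ≤ R_𝔽₃(⟨2,2,n⟩)`: IF every nowhere-zero `m : Fin r → 𝔽₃^{2×2}` satisfying the X-cap system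
`XCaps3 n r` is `InOrbit`-related to a member of `Reps` (ENUMERATION COMPLETE — engine-side), AND no
member of `Reps` is the X-marginal of an `r`-product computation (EVERY REPRESENTATIVE EXCLUDED —
engine-side), THEN `r + 1 ≤ R_𝔽₃(⟨2,2,n⟩)`. -/
theorem succ_le_tensorRank_22n_gf3_of_enumeration (r : ℕ)
    (hr : r ≤ tensorRank (matMulTensor (ZMod 3) 2 2 n))
    (Reps : Set (Fin r → Matrix (Fin 2) (Fin 2) (ZMod 3)))
    (henum : ∀ m : Fin r → Matrix (Fin 2) (Fin 2) (ZMod 3), (∀ i, m i ≠ 0) → XCaps3 n r m →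
      ∃ rep ∈ Reps, InOrbit m rep)
    (hexcl : ∀ rep ∈ Reps, ∀ β : BilinComp (mulBilin (ZMod 3) 2 2 n) (Fin r), xMarginal β ≠ rep) :
    r + 1 ≤ tensorRank (matMulTensor (ZMod 3) 2 2 n) :=
  succ_le_tensorRank_22n_of_orbit_census r Reps
    (fun β => henum _ (xMarginal_ne_zero_of_le_tensorRank hr β) (xCaps3_xMarginal β)) hexcl

/-- **The `⟨2,2,6⟩@20` cell.** With the kernel floor `20 ≤ R_𝔽₃(⟨2,2,6⟩)` (`3n + 2`): IF the census's
list `Reps` of representatives at `(n, r) = (6, 20)` is complete for the universe `XCaps3 6 20` AND every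
representative is excluded, THEN `21 ≤ R_𝔽₃(⟨2,2,6⟩)`. Both hypotheses are engine-side (1 148 orbits;
two code-disjoint engine exclusions each) and NOT proved here. -/
theorem twentyone_le_tensorRank_226_gf3_of_enumeration
    (Reps : Set (Fin 20 → Matrix (Fin 2) (Fin 2) (ZMod 3)))
    (henum : ∀ m : Fin 20 → Matrix (Fin 2) (Fin 2) (ZMod 3), (∀ i, m i ≠ 0) → XCaps3 6 20 m →
      ∃ rep ∈ Reps, InOrbit m rep)
    (hexcl : ∀ rep ∈ Reps, ∀ β : BilinComp (mulBilin (ZMod 3) 2 2 6) (Fin 20), xMarginal β ≠ rep) :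
    21 ≤ tensorRank (matMulTensor (ZMod 3) 2 2 6) :=
  succ_le_tensorRank_22n_gf3_of_enumeration 20
    (by have h := (tensorRank_matMulTensor_22n_gf3_window 6 (by norm_num)).1; omega) Reps henum hexcl

/-- **The `⟨2,2,6⟩@20` cell, with the Hopcroft–Kerr ceiling `⌈7·6/2⌉ = 21`:** under the same two
engine-side hypotheses, `R_𝔽₃(⟨2,2,6⟩) = 21`. NOT proved unconditionally here. -/
theorem tensorRank_226_gf3_eq_of_enumeration
    (Reps : Set (Fin 20 → Matrix (Fin 2) (Fin 2) (ZMod 3)))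
    (henum : ∀ m : Fin 20 → Matrix (Fin 2) (Fin 2) (ZMod 3), (∀ i, m i ≠ 0) → XCaps3 6 20 m →
      ∃ rep ∈ Reps, InOrbit m rep)
    (hexcl : ∀ rep ∈ Reps, ∀ β : BilinComp (mulBilin (ZMod 3) 2 2 6) (Fin 20), xMarginal β ≠ rep) :
    tensorRank (matMulTensor (ZMod 3) 2 2 6) = 21 := by
  have h1 := twentyone_le_tensorRank_226_gf3_of_enumeration Reps henum hexcl
  have h2 := hopcroftKerr1971_tensorRank_matMulTensor_22n_le (K := ZMod 3) 6
  omega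

/-- **The `⟨2,2,5⟩@17` cell, with the Hopcroft–Kerr ceiling `18`:** under the two engine-side
hypotheses of `eighteen_le_tensorRank_225_gf3_of_enumeration`, `R_𝔽₃(⟨2,2,5⟩) = 18`. NOT proved
unconditionally here. -/
theorem tensorRank_225_gf3_eq_of_enumeration
    (Reps : Set (Fin 17 → Matrix (Fin 2) (Fin 2) (ZMod 3)))
    (henum : ∀ m : Fin 17 → Matrix (Fin 2) (Fin 2) (ZMod 3), (∀ i, m i ≠ 0) → XCaps3 5 17 m →
      ∃ rep ∈ Reps, InOrbit m rep)
    (hexcl : ∀ rep ∈ Reps, ∀ β : BilinComp (mulBilin (ZMod 3) 2 2 5) (Fin 17), xMarginal β ≠ rep) :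
    tensorRank (matMulTensor (ZMod 3) 2 2 5) = 18 := by
  have h1 := eighteen_le_tensorRank_225_gf3_of_enumeration Reps henum hexcl
  have h2 := (tensorRank_matMulTensor_225_gf3_mem).2
  omega

/-- **The `⟨2,2,7⟩@23` cell.** With the kernel floor `23 ≤ R_𝔽₃(⟨2,2,7⟩)` (`3n + 2`, `⌈36n/11⌉`): IF the
census's list `Reps` of representatives at `(n, r) = (7, 23)` is complete for the universe `XCaps3 7 23`
(engine-side: six orbits) AND every representative is excluded (engine-side: two code-disjoint exact
engines), THEN `24 ≤ R_𝔽₃(⟨2,2,7⟩)` — one above the printed floor `23`. NOT proved unconditionally here. -/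
theorem twentyfour_le_tensorRank_227_gf3_of_enumeration
    (Reps : Set (Fin 23 → Matrix (Fin 2) (Fin 2) (ZMod 3)))
    (henum : ∀ m : Fin 23 → Matrix (Fin 2) (Fin 2) (ZMod 3), (∀ i, m i ≠ 0) → XCaps3 7 23 m →
      ∃ rep ∈ Reps, InOrbit m rep)
    (hexcl : ∀ rep ∈ Reps, ∀ β : BilinComp (mulBilin (ZMod 3) 2 2 7) (Fin 23), xMarginal β ≠ rep) :
    24 ≤ tensorRank (matMulTensor (ZMod 3) 2 2 7) :=
  succ_le_tensorRank_22n_gf3_of_enumeration 23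
    (by have h := (tensorRank_matMulTensor_22n_gf3_window 7 (by norm_num)).1; omega) Reps henum hexcl

/-- **The `⟨2,2,7⟩@23` cell, with the Hopcroft–Kerr ceiling `⌈7·7/2⌉ = 25`:** under the same two
engine-side hypotheses, `R_𝔽₃(⟨2,2,7⟩) ∈ [24, 25]`. NOT proved unconditionally here. -/
theorem tensorRank_227_gf3_mem_of_enumeration
    (Reps : Set (Fin 23 → Matrix (Fin 2) (Fin 2) (ZMod 3)))
    (henum : ∀ m : Fin 23 → Matrix (Fin 2) (Fin 2) (ZMod 3), (∀ i, m i ≠ 0) → XCaps3 7 23 m →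
      ∃ rep ∈ Reps, InOrbit m rep)
    (hexcl : ∀ rep ∈ Reps, ∀ β : BilinComp (mulBilin (ZMod 3) 2 2 7) (Fin 23), xMarginal β ≠ rep) :
    tensorRank (matMulTensor (ZMod 3) 2 2 7) ∈ Set.Icc 24 25 :=
  ⟨twentyfour_le_tensorRank_227_gf3_of_enumeration Reps henum hexcl,
    hopcroftKerr1971_tensorRank_matMulTensor_22n_le (K := ZMod 3) 7⟩

end Summit.MatrixMultiplication.OmegaCensus.RankOnePlaneCapGeneral
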